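import Summits.QuantumAdvantage.QuantumAdvantage.Theorems.LinnikCubicClassGroupsDegreeOnePrimesEscapeFrobeniusWindowSmoothedDH
import Summits.QuantumAdvantage.QuantumAdvantage.Theorems.LinnikCubicClassGroupsDegreeOnePrimesEscapeFrobeniusWindowPsi
import Summits.QuantumAdvantage.QuantumAdvantage.Theorems.LinnikCubicClassGroupsDegreeOnePrimesEscapeClassPNTDHNumerics
import HarnessLib

/-!
# The Chebotarev PNT for a cyclic extension in SHORT INTERVALS, `ψ`-form, with Deuring–Heilbronn

Topic `Summits/QuantumAdvantage/QuantumAdvantage/Theorems`, cell B2b-1 (linnik-cubic), PART A (gen 17); helper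
toward the crux `DegreeOnePrimesEscape` (stmt-QuantumAdvantage-11543) of route `LinnikCubicClassGroups`.
HONEST FRAMING: the value of this file is a THEOREM (kernel-checked, GRH-free, Siegel-free, unconditional) —
NOT summit progress.

`frobeniusWindowPsi_dichotomy_dh`: as `frobeniusWindowPsi_dichotomy` (for `n₀ > 1`, `0 < κ ≤ 1`: constants
`δ, a₂, c, c'`; for every cyclic `N|E` with `[N:ℚ] = n₀`, a faithful `χ₁` of `Gal(N|E)`, the Frobenius-weighted
`ψ_τ`, `m = [N:E]`, `Q = condQn N`, all `x ≥ Q^{a₂}`, `x^{1−δ} ≤ h ≤ x`: (A) no zero in the `c`-window ⟹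
`|mΔψ_τ − h| ≤ κ h`; (B) a zero `β₁` ⟹ `|mΔψ_τ − h| ≤ κ h + I`, `I = ((x+h)^{β₁} − x^{β₁})/β₁`; (B') `β₁` in the
`c'`-window ⟹ `|mΔψ_τ − (h − Re(χ₁(τ)^{−j₀}) I)| ≤ (error)` with one `j₀` for all `τ, x, h`,
`j₀ = 0 ↔ ζ₁_E(β₁) = 0`, `(χ₁(τ)^{j₀})² = 1`), except that in (B') the error is
`κ · min(1, (1−β₁) log x) · h` — RELATIVE to the flat main term `h − I ≍ h·min(1,(1−β₁) log x)`.
Inputs: the smoothed DH form `smoothedFrobeniusWindow_dichotomy_dh` (Deuring–Heilbronn repulsion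
[LagariasMontgomeryOdlyzko1979, Thm. 5.1] in `Q`-form, `deuringHeilbronn`), collars `ε = ε₀ log(1+h/x)` with
`ε₀ = e₀ Q^{−2}` and Stark's `1 − β₁ ≥ c₁ Q^{−2}` [Stark1974, Thm. 1'] so that collar and junk errors are also
relative; unsmoothing by monotonicity (`FrobeniusWindowUnsmoothing`).
References: [LagariasMontgomeryOdlyzko1979, §§3, 5, 7]; [ThornerZaman2019, Thm. 3.2]; S. Gun, S. L. Naik,
arXiv:2405.04698 (2024), Thm. 7.
-/

noncomputable section

open Complex Real Finset NumberField IsDedekindDomain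
open scoped NumberField nonZeroDivisors Classical

namespace Summit.QuantumAdvantage.QuantumAdvantage.Theorems.DegreeOnePrimesEscape

open Literature.NumberTheory.LFunctions Literature.NumberTheory.LFunctions.NumberField
  Literature.NumberTheory.LFunctions.EntireEF Literature.NumberTheory.LFunctions.WindowWeight
  Literature.NumberTheory.LFunctions.AbelianDensity Literature.NumberTheory.GaloisRepresentations

set_option maxHeartbeats 3200000 in
/-- **The Chebotarev prime number theorem for a cyclic extension in short intervals, `ψ`-form, two-sided,
with the exceptional zero of `ζ_N`, the sign of its coefficient, and Deuring–Heilbronn**: as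
`frobeniusWindowPsi_dichotomy`, but in clause (B') the error is `κ · min(1, (1−β₁) log x) · h`, i.e. RELATIVE to
the flat main term `h − I ≍ h·min(1,(1−β₁)log x)` for the classes with coefficient `+1`.
[cite: LagariasMontgomeryOdlyzko1979, §7, Theorem 1.1] [cite: ThornerZaman2019, Theorem 3.1] -/
theorem frobeniusWindowPsi_dichotomy_dh (n₀ : ℕ) (hn₀ : 1 < n₀) {κ : ℝ} (hκ : 0 < κ) (hκ1 : κ ≤ 1) :
    ∃ δ a₂ c c' : ℝ, 0 < δ ∧ δ ≤ 1 / 64 ∧ 1 ≤ a₂ ∧ 0 < c ∧ c ≤ 1 / (8 * ((n₀ : ℝ) ^ 2 + 1)) ∧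
      0 < c' ∧ c' ≤ c ∧
    ∀ (E N : Type) [Field E] [NumberField E] [Field N] [NumberField N] [Algebra E N] [IsGalois E N]
      [IsCyclic (N ≃ₐ[E] N)], Module.finrank ℚ N = n₀ →
    ∃ χ₁ : (N ≃ₐ[E] N) →* ℂˣ, Function.Injective χ₁ ∧
      (∀ (τ : N ≃ₐ[E] N) (wτ : Ideal (𝓞 E) → ℝ),
        (∀ I, wτ I = if (∃ v : HeightOneSpectrum (𝓞 E), Algebra.IsUnramifiedIn (𝓞 N) v.asIdeal ∧
          ∃ k : ℕ, I = v.asIdeal ^ k ∧ galFrob E N v ^ k = τ) then 1 else 0) →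
        ∀ x h : ℝ, ThornerZaman.condQn N ^ a₂ ≤ x → x ^ (1 - δ) ≤ h → h ≤ x →
          (¬ ∃ β₁ : ℝ, dedekindZeta₁ N β₁ = 0 ∧
            1 - c / (Real.log ((NumberField.discr N).natAbs : ℝ) + Real.log 4) < β₁ ∧ β₁ < 1) →
          |(Module.finrank E N : ℝ) *
              ((∑ n ∈ Icc 0 ⌊x + h⌋₊, ∑ I ∈ idealsOfNorm E n, wτ I * idealVonMangoldt I) -
                (∑ n ∈ Icc 0 ⌊x⌋₊, ∑ I ∈ idealsOfNorm E n, wτ I * idealVonMangoldt I)) - h| ≤ κ * h) ∧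
      (∀ β₁ : ℝ, dedekindZeta₁ N β₁ = 0 →
          1 - c / (Real.log ((NumberField.discr N).natAbs : ℝ) + Real.log 4) < β₁ → β₁ < 1 →
        ∀ (τ : N ≃ₐ[E] N) (wτ : Ideal (𝓞 E) → ℝ),
          (∀ I, wτ I = if (∃ v : HeightOneSpectrum (𝓞 E), Algebra.IsUnramifiedIn (𝓞 N) v.asIdeal ∧
            ∃ k : ℕ, I = v.asIdeal ^ k ∧ galFrob E N v ^ k = τ) then 1 else 0) →
        ∀ x h : ℝ, ThornerZaman.condQn N ^ a₂ ≤ x → x ^ (1 - δ) ≤ h → h ≤ x →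
            |(Module.finrank E N : ℝ) *
                ((∑ n ∈ Icc 0 ⌊x + h⌋₊, ∑ I ∈ idealsOfNorm E n, wτ I * idealVonMangoldt I) -
                  (∑ n ∈ Icc 0 ⌊x⌋₊, ∑ I ∈ idealsOfNorm E n, wτ I * idealVonMangoldt I)) - h| ≤
              κ * h + ((x + h) ^ β₁ - x ^ β₁) / β₁) ∧
      (∀ β₁ : ℝ, dedekindZeta₁ N β₁ = 0 →
          1 - c' / (Real.log ((NumberField.discr N).natAbs : ℝ) + Real.log 4) < β₁ → β₁ < 1 →
        ∃ j₀ : ℕ, j₀ < Module.finrank E N ∧ (j₀ = 0 ↔ dedekindZeta₁ E β₁ = 0) ∧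
        (∀ τ : N ≃ₐ[E] N, ((((χ₁ τ : ℂˣ) : ℂ)) ^ j₀) ^ 2 = 1) ∧
        ∀ (τ : N ≃ₐ[E] N) (wτ : Ideal (𝓞 E) → ℝ),
          (∀ I, wτ I = if (∃ v : HeightOneSpectrum (𝓞 E), Algebra.IsUnramifiedIn (𝓞 N) v.asIdeal ∧
            ∃ k : ℕ, I = v.asIdeal ^ k ∧ galFrob E N v ^ k = τ) then 1 else 0) →
          ∀ x h : ℝ, ThornerZaman.condQn N ^ a₂ ≤ x → x ^ (1 - δ) ≤ h → h ≤ x →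
            |(Module.finrank E N : ℝ) *
                ((∑ n ∈ Icc 0 ⌊x + h⌋₊, ∑ I ∈ idealsOfNorm E n, wτ I * idealVonMangoldt I) -
                  (∑ n ∈ Icc 0 ⌊x⌋₊, ∑ I ∈ idealsOfNorm E n, wτ I * idealVonMangoldt I)) -
                (h - ((((χ₁ τ : ℂˣ) : ℂ)⁻¹) ^ j₀).re * (((x + h) ^ β₁ - x ^ β₁) / β₁))| ≤
              κ * min 1 ((1 - β₁) * Real.log x) * h) := by
  classical
  -- precision split: smoothed error `κ/4`, collars `24 ε₀ ≤ (κ/4) c₁ Q^{-2}`, junk `(κ/4) c₁ Q^{-2}`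
  have hκ4 : 0 < κ / 4 := by positivity
  obtain ⟨c₁, hc₁, hc₁1, heff⟩ := Residue.one_sub_realZero_ge_condQn_rpow n₀ hn₀
  set e₀ : ℝ := min (1 / 4) (κ * c₁ / 96) with he₀
  have he₀0 : 0 < e₀ := lt_min (by norm_num) (by positivity)
  have he₀1 : e₀ ≤ 1 / 4 := min_le_left _ _
  have he₀κ : e₀ ≤ κ * c₁ / 96 := min_le_right _ _
  obtain ⟨θ, a₁, c, c', hθ0, hθ1, ha₁1, hc, hcn, hc'0, hc'c, hmain⟩ :=
    smoothedFrobeniusWindow_dichotomy_dh n₀ hn₀ hκ4 he₀0 he₀1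
  have hn2 : (2 : ℝ) ≤ n₀ := by exact_mod_cast hn₀
  set δ : ℝ := θ / 8 with hδ
  have hδ0 : 0 < δ := by positivity
  have hδ64 : δ ≤ 1 / 64 := by rw [hδ]; linarith
  have hν0 : 0 < 1 - 2 * δ := by linarith
  set MJ : ℝ := 64 / (κ * c₁ * δ) with hMJ
  have hMJ0 : 0 < MJ := by positivity
  set a₂ : ℝ := max a₁ ((4 + max 0 (Real.log MJ)) / (1 - 2 * δ)) with ha₂
  have ha₂a₁ : a₁ ≤ a₂ := le_max_left _ _
  have ha₂J : (4 + max 0 (Real.log MJ)) / (1 - 2 * δ) ≤ a₂ := le_max_right _ _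
  have ha₂1 : 1 ≤ a₂ := ha₁1.trans ha₂a₁
  refine ⟨δ, a₂, c, c', hδ0, hδ64, ha₂1, hc, hcn, hc'0, hc'c, ?_⟩
  intro E N _ _ _ _ _ _ _ hNn
  obtain ⟨χ₁, hχ₁, hcaseA, hcaseB, hcaseB'⟩ := hmain E N hNn
  haveI : FiniteDimensional E N := Module.Finite.of_restrictScalars_finite ℚ E N
  have hN : 1 < Module.finrank ℚ N := by rw [hNn]; exact hn₀
  set mN : ℕ := Module.finrank E N with hmN
  have hm0 : (0 : ℝ) ≤ mN := Nat.cast_nonneg _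
  set Q : ℝ := ThornerZaman.condQn N with hQ
  have hQ12 : (12 : ℝ) ≤ Q := ThornerZaman.twelve_le_condQn (K := N) hN
  have hQ1 : (1 : ℝ) < Q := by linarith
  have hQ0 : (0 : ℝ) < Q := by linarith
  have hn₀Q : (n₀ : ℝ) ≤ Q := by rw [← hNn]; exact ThornerZaman.finrank_le_condQn (K := N)
  -- the collar ratio `ε₀ = e₀ Q^{-2}`
  have hQm2 : 0 < Q ^ (-(2 : ℝ)) := Real.rpow_pos_of_pos hQ0 _
  have hQm2' : Q ^ (-(2 : ℝ)) = (Q ^ (2 : ℕ))⁻¹ := by rw [Real.rpow_neg hQ0.le, Real.rpow_two]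
  have hQm2le : Q ^ (-(2 : ℝ)) ≤ 1 := Real.rpow_le_one_of_one_le_of_nonpos hQ1.le (by norm_num)
  set ε₀ : ℝ := e₀ * Q ^ (-(2 : ℝ)) with hε₀
  have hε₀0 : 0 < ε₀ := mul_pos he₀0 hQm2
  have hε₀Q : e₀ * ThornerZaman.condQn N ^ (-(2 : ℝ)) ≤ ε₀ := le_rfl
  have hε₀1 : ε₀ ≤ 1 / 4 := by
    have := mul_le_mul he₀1 hQm2le hQm2.le (by norm_num); rw [hε₀]; linarith
  have hc₁Q1 : c₁ * Q ^ (-(2 : ℝ)) ≤ 1 := (mul_le_mul hc₁1 hQm2le hQm2.le zero_le_one).trans (by norm_num)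
  have h24 : 24 * ε₀ ≤ κ / 4 * (c₁ * Q ^ (-(2 : ℝ))) := by
    rw [hε₀]; have := mul_le_mul_of_nonneg_right he₀κ hQm2.le; nlinarith
  -- `ω(d_N) ≤ 2Q`
  have hω : (((NumberField.discr N).natAbs.primeFactors.card : ℕ) : ℝ) ≤ 2 * Q := by
    have h1 : (NumberField.discr N).natAbs.primeFactors.card ≤ (NumberField.discr N).natAbs := by
      calc (NumberField.discr N).natAbs.primeFactors.card ≤ (Finset.Icc 1 (NumberField.discr N).natAbs).card :=
            Finset.card_le_card fun p hp ↦ Finset.mem_Icc.mpr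
              ⟨(Nat.prime_of_mem_primeFactors hp).one_lt.le, Nat.le_of_mem_primeFactors hp⟩
        _ = (NumberField.discr N).natAbs := by simp
    have h2 : ((NumberField.discr N).natAbs : ℝ) ≤ Q := by rw [hQ]; exact natAbs_discr_le_condQn N
    have h3 : (((NumberField.discr N).natAbs.primeFactors.card : ℕ) : ℝ) ≤ (NumberField.discr N).natAbs := by
      exact_mod_cast h1
    linarith
  have hw01 : ∀ (τ : N ≃ₐ[E] N) (wτ : Ideal (𝓞 E) → ℝ),
      (∀ I, wτ I = if (∃ v : HeightOneSpectrum (𝓞 E), Algebra.IsUnramifiedIn (𝓞 N) v.asIdeal ∧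
        ∃ k : ℕ, I = v.asIdeal ^ k ∧ galFrob E N v ^ k = τ) then 1 else 0) →
      (∀ I, 0 ≤ wτ I) ∧ ∀ I, wτ I ≤ 1 := by
    intro τ wτ hwτ
    exact ⟨fun I ↦ by rw [hwτ I]; split_ifs <;> norm_num, fun I ↦ by rw [hwτ I]; split_ifs <;> norm_num⟩
  -- the common window data at `x ≥ Q^{a₂}`, `x^{1−δ} ≤ h ≤ x`
  have hcommon : ∀ x h : ℝ, Q ^ a₂ ≤ x → x ^ (1 - δ) ≤ h → h ≤ x →
      Q ^ a₁ ≤ x ∧ 1 < x ∧ 0 < h ∧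
      ∃ η : ℝ, 0 < η ∧ η ≤ Real.log 2 ∧ Real.exp (-(θ / 8) * Real.log x) ≤ 2 * η ∧
        Real.log (x + h) = Real.log x + η ∧ x * η ≤ h ∧ Real.exp (Real.log x + η) = x + h ∧
        2 * (ε₀ * η) < η ∧ 2 ≤ Real.log x ∧ ε₀ * η ≤ 1 ∧
        (n₀ : ℝ) * ((NumberField.discr N).natAbs.primeFactors.card) * (Real.log x + 2) ≤ κ / 4 * (c₁ * Q ^ (-(2 : ℝ))) * h := by
    intro x h hx hhx hhx'
    have hxa₁ : Q ^ a₁ ≤ x := le_trans (Real.rpow_le_rpow_of_exponent_le hQ1.le ha₂a₁) hx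
    have hxQ : Q ≤ x := by
      have : Q ^ (1 : ℝ) ≤ Q ^ a₂ := Real.rpow_le_rpow_of_exponent_le hQ1.le ha₂1
      rw [Real.rpow_one] at this; linarith
    have hx1 : 1 < x := by linarith
    have hx0 : 0 < x := by linarith
    set L : ℝ := Real.log x with hL
    have hL0 : 0 < L := Real.log_pos hx1
    obtain ⟨-, -, hlog12⟩ := log_small_consts
    have hlogQ : 2 ≤ Real.log Q := hlog12.trans (Real.log_le_log (by norm_num) hQ12)
    have hLQ : a₂ * Real.log Q ≤ L := by
      have := Real.log_le_log (by positivity) hx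
      rwa [Real.log_rpow (by linarith)] at this
    have hδpos : 0 < x ^ (1 - δ) := Real.rpow_pos_of_pos hx0 _
    have hh0 : 0 < h := lt_of_lt_of_le hδpos hhx
    set t : ℝ := h / x with ht
    have ht0 : 0 < t := by positivity
    have ht1 : t ≤ 1 := by rw [ht, div_le_one hx0]; exact hhx'
    have hxt : x * t = h := by rw [ht]; field_simp
    have hxh : x + h = x * (1 + t) := by rw [mul_add, mul_one, hxt]
    set η : ℝ := Real.log (1 + t) with hη
    have hη0 : 0 < η := Real.log_pos (by linarith)
    have hη1 : η ≤ Real.log 2 := Real.log_le_log (by linarith) (by linarith)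
    have hηt : t / 2 ≤ η := by
      have h1 := Real.one_sub_inv_le_log_of_pos (show (0 : ℝ) < 1 + t by linarith)
      have h2 : t / 2 ≤ 1 - (1 + t)⁻¹ := by
        rw [show 1 - (1 + t)⁻¹ = t / (1 + t) by field_simp; ring]
        exact div_le_div_of_nonneg_left ht0.le (by linarith) (by linarith)
      linarith
    have hηt' : η ≤ t := by
      have := Real.log_le_sub_one_of_pos (show (0 : ℝ) < 1 + t by linarith); rw [hη]; linarith
    have hlogxh : Real.log (x + h) = L + η := by
      rw [hxh, Real.log_mul hx0.ne' (by linarith), hL, hη]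
    have hηx : Real.exp (-(θ / 8) * Real.log x) ≤ 2 * η := by
      have h1 : Real.exp (-(θ / 8) * Real.log x) = x ^ (1 - θ / 8) / x := by
        rw [Real.rpow_def_of_pos hx0, eq_div_iff hx0.ne', ← Real.exp_log hx0, ← Real.exp_add, Real.exp_log hx0]
        congr 1; ring
      rw [h1]
      have h2 : x ^ (1 - θ / 8) / x ≤ h / x := div_le_div_of_nonneg_right (by rw [← hδ]; exact hhx) hx0.le
      linarith
    have hxη : x * η ≤ h := by
      have := mul_le_mul_of_nonneg_left hηt' hx0.le; rw [hxt] at this; exact this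
    have hexpη : Real.exp (L + η) = x + h := by
      rw [Real.exp_add, hL, Real.exp_log hx0, hη, Real.exp_log (by linarith), hxh]
    have h2ε : 2 * (ε₀ * η) < η := by nlinarith
    have hMJ64 : (64 : ℝ) ≤ MJ := by
      rw [hMJ, le_div_iff₀ (by positivity)]
      have h1 : κ * c₁ ≤ 1 * 1 := mul_le_mul hκ1 hc₁1 hc₁.le zero_le_one
      have h2 : κ * c₁ * δ ≤ 1 * (1 / 64) := mul_le_mul (by linarith) hδ64 hδ0.le zero_le_one
      linarith
    have hlogMJ : 4 ≤ Real.log MJ := by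
      have h4 : Real.log 64 = 6 * Real.log 2 := by
        rw [show (64 : ℝ) = 2 ^ 6 by norm_num, Real.log_pow]; push_cast; ring
      have := Real.log_le_log (by norm_num) hMJ64
      have hl2 := Real.log_two_gt_d9
      linarith
    have ha₂6 : 6 ≤ a₂ := by
      have h1 : 4 + max 0 (Real.log MJ) ≤ (4 + max 0 (Real.log MJ)) / (1 - 2 * δ) := by
        rw [le_div_iff₀ hν0]; nlinarith [le_max_left 0 (Real.log MJ)]
      have h2 : Real.log MJ ≤ max 0 (Real.log MJ) := le_max_right _ _
      linarith
    have hL16 : 2 ≤ L := by nlinarith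
    have hJ : (n₀ : ℝ) * ((NumberField.discr N).natAbs.primeFactors.card) * (Real.log x + 2) ≤
        κ / 4 * (c₁ * Q ^ (-(2 : ℝ))) * h := by
      have hth := mul_rpow_neg_le_one_of_threshold (k := 4) (M := MJ) hQ12 hx hν0 hMJ0
        (by have := (div_le_iff₀ hν0).1 ha₂J; linarith)
      have hlogx : Real.log x + 2 ≤ 2 * (x ^ δ / δ) := by
        have h1 : Real.log x ≤ x ^ δ / δ := Real.log_le_rpow_div hx0.le hδ0
        rw [← hL] at h1 ⊢; linarith
      have hxδ0 : 0 < x ^ δ := Real.rpow_pos_of_pos hx0 _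
      have hcomb : x ^ (-(1 - 2 * δ)) * x ^ (1 - δ) = x ^ δ := by
        rw [← Real.rpow_add hx0]; congr 1; ring
      have hQ4 : Q ^ (4 : ℝ) = Q ^ (4 : ℕ) := by exact_mod_cast Real.rpow_natCast Q 4
      have h1 : (n₀ : ℝ) * ((NumberField.discr N).natAbs.primeFactors.card) * (Real.log x + 2) ≤
          Q * (2 * Q) * (2 * (x ^ δ / δ)) :=
        mul_le_mul (mul_le_mul hn₀Q hω (Nat.cast_nonneg _) hQ0.le) hlogx (by linarith) (by positivity)
      have h3 : MJ * Q ^ (4 : ℝ) * x ^ (-(1 - 2 * δ)) ≤ 1 := hth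
      rw [hQ4] at h3
      -- `Q·2Q·2x^δ/δ · Q² = (κc₁/16)·(MJ Q⁴ x^{−(1−2δ)})·x^{1−δ}`
      have h4 : Q * (2 * Q) * (2 * (x ^ δ / δ)) * Q ^ (2 : ℕ) =
          (κ * c₁ / 16) * (MJ * Q ^ (4 : ℕ) * x ^ (-(1 - 2 * δ))) * x ^ (1 - δ) := by
        rw [hMJ]
        have e1 : Q * (2 * Q) * (2 * (x ^ δ / δ)) * Q ^ (2 : ℕ) = 4 * Q ^ (4 : ℕ) * x ^ δ / δ := by ring
        rw [e1, ← hcomb]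
        field_simp
        ring
      have h5 : (κ * c₁ / 16) * (MJ * Q ^ (4 : ℕ) * x ^ (-(1 - 2 * δ))) * x ^ (1 - δ) ≤ (κ * c₁ / 16) * 1 * x ^ (1 - δ) :=
        mul_le_mul_of_nonneg_right (mul_le_mul_of_nonneg_left h3 (by positivity)) hδpos.le
      have hQsq : 0 < Q ^ (2 : ℕ) := by positivity
      have h6 : (n₀ : ℝ) * ((NumberField.discr N).natAbs.primeFactors.card) * (Real.log x + 2) * Q ^ (2 : ℕ) ≤
          κ * c₁ / 16 * h := by
        have := mul_le_mul_of_nonneg_right h1 hQsq.le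
        nlinarith [mul_le_mul_of_nonneg_left hhx (by positivity : (0:ℝ) ≤ κ * c₁ / 16)]
      rw [hQm2']
      rw [← le_div_iff₀ hQsq] at h6
      have hT : 0 ≤ κ / 4 * (c₁ * (Q ^ (2 : ℕ))⁻¹) * h := by positivity
      calc (n₀ : ℝ) * ((NumberField.discr N).natAbs.primeFactors.card) * (Real.log x + 2) ≤ κ * c₁ / 16 * h / Q ^ (2 : ℕ) := h6
        _ = (1 / 4) * (κ / 4 * (c₁ * (Q ^ (2 : ℕ))⁻¹) * h) := by field_simp; ring
        _ ≤ κ / 4 * (c₁ * (Q ^ (2 : ℕ))⁻¹) * h := by linarith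
    have hεη1 : ε₀ * η ≤ 1 := by
      have hlog2 : Real.log 2 < 0.6931471808 := Real.log_two_lt_d9
      have := mul_le_mul hε₀1 hη1 hη0.le (by norm_num); linarith
    exact ⟨hxa₁, hx1, hh0, η, hη0, hη1, hηx, hlogxh, hxη, hexpη, h2ε, hL16, hεη1, hJ⟩
  -- conversion of the complex smoothed bounds into real form
  have hreal : ∀ (wτ : Ideal (𝓞 E) → ℝ) (lo hi ε : ℝ) (cc : ℂ) (σ B : ℝ), 0 < ε → ε ≤ lo → lo ≤ hi →
      ‖(mN : ℂ) * ((∑' k : ℕ, (∑ I ∈ idealsOfNorm E k, wτ I * idealVonMangoldt I) *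
            windowTest lo hi ε (Real.log k) : ℝ) : ℂ) -
          fordLaplace (windowTest lo hi ε) (-1) + cc * fordLaplace (windowTest lo hi ε) (-(σ : ℂ))‖ ≤ B →
      (mN : ℝ) * (∑' k : ℕ, (∑ I ∈ idealsOfNorm E k, wτ I * idealVonMangoldt I) * windowTest lo hi ε (Real.log k)) ≤
          (fordLaplace (windowTest lo hi ε) (-1)).re - cc.re * (fordLaplace (windowTest lo hi ε) (-(σ : ℂ))).re + B ∧
      (fordLaplace (windowTest lo hi ε) (-1)).re - cc.re * (fordLaplace (windowTest lo hi ε) (-(σ : ℂ))).re - B ≤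
        (mN : ℝ) * (∑' k : ℕ, (∑ I ∈ idealsOfNorm E k, wτ I * idealVonMangoldt I) * windowTest lo hi ε (Real.log k)) := by
    intro wτ lo hi ε cc σ B hε0 hεlo hlohi hB
    have h1 := (Complex.abs_re_le_norm _).trans hB
    have hFreal : (fordLaplace (windowTest lo hi ε) (-(σ : ℂ))).im = 0 :=
      fordLaplace_windowTest_real_im hε0 (by linarith) σ
    simp only [Complex.add_re, Complex.sub_re, Complex.mul_re, Complex.natCast_re, Complex.natCast_im,
      Complex.ofReal_re, Complex.ofReal_im, mul_zero, sub_zero, hFreal] at h1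
    rw [abs_le] at h1
    constructor <;> linarith [h1.1, h1.2]
  -- the two-window sandwich
  refine ⟨χ₁, hχ₁, fun τ wτ hwτ x h hx hhx hhx' hnoexc ↦ ?_, fun β₁ hζ hwin hβ1 τ wτ hwτ x h hx hhx hhx' ↦ ?_,
    fun β₁ hζ hwin hβ1 ↦ ?_⟩
  · -- (A): `rU = rD = 0`, `σ = 1`
    obtain ⟨hxa₁, hx1, hh0, η, hη0, hη1, hηx, hlogxh, hxη, hexpη, h2ε, hL16, hεη1, hJ⟩ := hcommon x h hx hhx hhx'
    have hε0 : 0 < ε₀ * η := by positivity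
    have hAup := hcaseA τ wτ hwτ ε₀ hε₀Q hε₀1 x η hxa₁ hη0 hη1 hηx (Real.log x) (Real.log x + η) le_rfl (by linarith) le_rfl hnoexc
    have hAlo := hcaseA τ wτ hwτ ε₀ hε₀Q hε₀1 x η hxa₁ hη0 hη1 hηx (Real.log x + ε₀ * η) (Real.log x + η - ε₀ * η)
      (by linarith) (by linarith) (by linarith) hnoexc
    have hup := (hreal wτ (Real.log x) (Real.log x + η) (ε₀ * η) 0 1 _ hε0 (by linarith) (by linarith)
      (by simpa using hAup)).1
    have hlow := (hreal wτ (Real.log x + ε₀ * η) (Real.log x + η - ε₀ * η) (ε₀ * η) 0 1 _ hε0 (by linarith)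
      (by linarith) (by simpa using hAlo)).2
    simp only [Complex.zero_re, zero_mul, sub_zero] at hup hlow
    have key := window_sandwich (hw01 τ wτ hwτ).1 hm0 (κ := κ / 4)
      (J := (n₀ : ℝ) * ((NumberField.discr N).natAbs.primeFactors.card) * (Real.log x + 2))
      hx1 hh0 hhx' hη0 hlogxh hxη hexpη hε₀0 hε₀1 h2ε hL16 hκ4 (rU := 0) (rD := 0) (σ := 1)
      (by norm_num) (by norm_num) (by norm_num) le_rfl (by simpa using hup) (by simpa using hlow)
    simp only [zero_mul, sub_zero] at key
    have h24h : 24 * ε₀ * h ≤ κ / 4 * h := by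
      have := mul_le_mul_of_nonneg_right h24 hh0.le; nlinarith [mul_nonneg hκ4.le hh0.le]
    have hJ' : (n₀ : ℝ) * ((NumberField.discr N).natAbs.primeFactors.card) * (Real.log x + 2) ≤ κ / 4 * h :=
      hJ.trans (by nlinarith [mul_nonneg hκ4.le hh0.le])
    rw [abs_le]; constructor <;> linarith [key.1, key.2, hJ', h24h]
  · -- (B): indices of the two windows may differ; bound the `β₁`-term by `I₀` on both sides
    obtain ⟨hxa₁, hx1, hh0, η, hη0, hη1, hηx, hlogxh, hxη, hexpη, h2ε, hL16, hεη1, hJ⟩ := hcommon x h hx hhx hhx'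
    have hε0 : 0 < ε₀ * η := by positivity
    have hx0 : 0 < x := by linarith
    have hβhalf : 1 / 2 ≤ β₁ := half_le_of_window (N := N) (n₀ := n₀) hcn hwin
    obtain ⟨j₀, -, hBup⟩ := hcaseB β₁ hζ hwin hβ1 ε₀ hε₀Q hε₀1 x η hxa₁ hη0 hη1 hηx (Real.log x) (Real.log x + η) le_rfl
      (by linarith) le_rfl
    obtain ⟨j₁, -, hBlo⟩ := hcaseB β₁ hζ hwin hβ1 ε₀ hε₀Q hε₀1 x η hxa₁ hη0 hη1 hηx (Real.log x + ε₀ * η)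
      (Real.log x + η - ε₀ * η) (by linarith) (by linarith) (by linarith)
    set rU : ℝ := ((((χ₁ τ : ℂˣ) : ℂ)⁻¹) ^ j₀).re with hrU
    set rD : ℝ := ((((χ₁ τ : ℂˣ) : ℂ)⁻¹) ^ j₁).re with hrD
    have hrU1 : |rU| ≤ 1 := by
      refine (Complex.abs_re_le_norm _).trans ?_
      rw [norm_pow]; exact pow_le_one₀ (norm_nonneg _) (norm_inv_character_le_one χ₁ τ)
    have hrD1 : |rD| ≤ 1 := by
      refine (Complex.abs_re_le_norm _).trans ?_
      rw [norm_pow]; exact pow_le_one₀ (norm_nonneg _) (norm_inv_character_le_one χ₁ τ)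
    have hμle : κ / 4 * x * η * min 1 ((1 - β₁) * Real.log x) ≤ κ / 4 * x * η := by
      have h1 : min 1 ((1 - β₁) * Real.log x) ≤ 1 := min_le_left _ _
      have h0 : 0 ≤ κ / 4 * x * η := by positivity
      nlinarith
    have hup := (hreal wτ (Real.log x) (Real.log x + η) (ε₀ * η) _ β₁ (κ / 4 * x * η + ((n₀ : ℝ) * ((NumberField.discr N).natAbs.primeFactors.card) * (Real.log x + 2))) hε0 (by linarith)
      (by linarith) ((hBup τ wτ hwτ).trans (by linarith [hμle]))).1
    have hlow := (hreal wτ (Real.log x + ε₀ * η) (Real.log x + η - ε₀ * η) (ε₀ * η) _ β₁ (κ / 4 * x * η + ((n₀ : ℝ) * ((NumberField.discr N).natAbs.primeFactors.card) * (Real.log x + 2))) hε0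
      (by linarith) (by linarith) ((hBlo τ wτ hwτ).trans (by linarith [hμle]))).2
    have key := window_sandwich (hw01 τ wτ hwτ).1 hm0 (κ := κ / 4)
      (J := (n₀ : ℝ) * ((NumberField.discr N).natAbs.primeFactors.card) * (Real.log x + 2))
      hx1 hh0 hhx' hη0 hlogxh hxη hexpη hε₀0 hε₀1 h2ε hL16 hκ4 hrU1 hrD1 hβhalf hβ1.le hup hlow
    have hmt : (Real.exp (β₁ * (Real.log x + η)) - Real.exp (β₁ * Real.log x)) / β₁ =
        ((x + h) ^ β₁ - x ^ β₁) / β₁ := by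
      rw [Real.rpow_def_of_pos (by linarith : (0:ℝ) < x + h), Real.rpow_def_of_pos hx0, hlogxh]
      ring_nf
    rw [hmt] at key
    have hI0 : 0 ≤ ((x + h) ^ β₁ - x ^ β₁) / β₁ := by
      refine div_nonneg ?_ (by linarith)
      have := Real.rpow_le_rpow hx0.le (show x ≤ x + h by linarith) (by linarith : 0 ≤ β₁)
      linarith
    have hrU' := abs_le.1 hrU1
    have hrD' := abs_le.1 hrD1
    have h24h : 24 * ε₀ * h ≤ κ / 4 * h := by
      have := mul_le_mul_of_nonneg_right h24 hh0.le; nlinarith [mul_nonneg hκ4.le hh0.le]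
    have hJ' : (n₀ : ℝ) * ((NumberField.discr N).natAbs.primeFactors.card) * (Real.log x + 2) ≤ κ / 4 * h :=
      hJ.trans (by nlinarith [mul_nonneg hκ4.le hh0.le])
    have hI1 : rD * (((x + h) ^ β₁ - x ^ β₁) / β₁) ≤ 1 * (((x + h) ^ β₁ - x ^ β₁) / β₁) :=
      mul_le_mul_of_nonneg_right hrD'.2 hI0
    have hI2 : (-1) * (((x + h) ^ β₁ - x ^ β₁) / β₁) ≤ rU * (((x + h) ^ β₁ - x ^ β₁) / β₁) :=
      mul_le_mul_of_nonneg_right hrU'.1 hI0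
    have hκh : 0 ≤ κ * h := by positivity
    rw [abs_le]; constructor <;> linarith [key.1, key.2, hJ', h24h, hI1, hI2, hκh]
  · -- (B'): one index `j₀` for all windows
    obtain ⟨j₀, hj₀m, hiff, hsq, hB⟩ := hcaseB' β₁ hζ hwin hβ1
    refine ⟨j₀, hj₀m, hiff, hsq, fun τ wτ hwτ x h hx hhx hhx' ↦ ?_⟩
    obtain ⟨hxa₁, hx1, hh0, η, hη0, hη1, hηx, hlogxh, hxη, hexpη, h2ε, hL16, hεη1, hJ⟩ := hcommon x h hx hhx hhx'
    have hε0 : 0 < ε₀ * η := by positivity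
    have hx0 : 0 < x := by linarith
    have hβhalf : 1 / 2 ≤ β₁ := half_le_of_window (N := N) (n₀ := n₀) (hc'c.trans hcn) hwin
    set r : ℝ := ((((χ₁ τ : ℂˣ) : ℂ)⁻¹) ^ j₀).re with hr
    have hr1 : |r| ≤ 1 := by
      refine (Complex.abs_re_le_norm _).trans ?_
      rw [norm_pow]; exact pow_le_one₀ (norm_nonneg _) (norm_inv_character_le_one χ₁ τ)
    set μ : ℝ := min 1 ((1 - β₁) * Real.log x) with hμ
    have hμ0 : 0 < μ := lt_min one_pos (mul_pos (by linarith) (Real.log_pos hx1))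
    have hκμ : 0 < κ / 4 * μ := mul_pos hκ4 hμ0
    have e1 : κ / 4 * x * η * μ = κ / 4 * μ * x * η := by ring
    have hup := (hreal wτ (Real.log x) (Real.log x + η) (ε₀ * η) _ β₁ _ hε0 (by linarith) (by linarith)
      (hB τ wτ hwτ ε₀ hε₀Q hε₀1 x η hxa₁ hη0 hη1 hηx (Real.log x) (Real.log x + η) le_rfl (by linarith) le_rfl)).1
    have hlow := (hreal wτ (Real.log x + ε₀ * η) (Real.log x + η - ε₀ * η) (ε₀ * η) _ β₁ _ hε0 (by linarith)
      (by linarith) (hB τ wτ hwτ ε₀ hε₀Q hε₀1 x η hxa₁ hη0 hη1 hηx (Real.log x + ε₀ * η) (Real.log x + η - ε₀ * η)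
        (by linarith) (by linarith) (by linarith))).2
    rw [← hμ, e1] at hup hlow
    have key := window_sandwich (hw01 τ wτ hwτ).1 hm0 (κ := κ / 4 * μ)
      (J := (n₀ : ℝ) * ((NumberField.discr N).natAbs.primeFactors.card) * (Real.log x + 2))
      hx1 hh0 hhx' hη0 hlogxh hxη hexpη hε₀0 hε₀1 h2ε hL16 hκμ hr1 hr1 hβhalf hβ1.le hup hlow
    have hmt : (Real.exp (β₁ * (Real.log x + η)) - Real.exp (β₁ * Real.log x)) / β₁ =
        ((x + h) ^ β₁ - x ^ β₁) / β₁ := by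
      rw [Real.rpow_def_of_pos (by linarith : (0:ℝ) < x + h), Real.rpow_def_of_pos hx0, hlogxh]
      ring_nf
    rw [hmt] at key
    -- Stark: `c₁ Q^{-2} ≤ 1 − β₁ ≤ μ`
    have hβ1ne : ((β₁ : ℝ) : ℂ) ≠ 1 := by
      intro h'; apply hβ1.ne; exact_mod_cast h'
    have hLzero : classGroupLFunction N 1 β₁ = 0 := by
      have := classGroupLFunction_eq_zero_of_famF (K := N) 0 (ρ := (β₁ : ℂ)) (by rw [famF_zero]; exact hζ) hβ1ne
      rwa [toHomUnits_toMulHom_zero] at this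
    have h11 : (1 : ClassGroup (𝓞 N) →* ℂˣ) * 1 = 1 := by ext; simp
    have hδlow : c₁ * Q ^ (-(2 : ℝ)) ≤ 1 - β₁ := heff N hNn 1 h11 β₁ hβ1 hLzero
    have hμlow : c₁ * Q ^ (-(2 : ℝ)) ≤ μ := by
      refine le_min hc₁Q1 (hδlow.trans ?_)
      have := mul_le_mul_of_nonneg_left (show (1:ℝ) ≤ Real.log x by linarith) (by linarith : (0:ℝ) ≤ 1 - β₁)
      linarith
    have h24h : 24 * ε₀ * h ≤ κ / 4 * μ * h := by
      have := mul_le_mul_of_nonneg_right (h24.trans (mul_le_mul_of_nonneg_left hμlow hκ4.le)) hh0.le; linarith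
    have hJ' : (n₀ : ℝ) * ((NumberField.discr N).natAbs.primeFactors.card) * (Real.log x + 2) ≤ κ / 4 * μ * h :=
      hJ.trans (mul_le_mul_of_nonneg_right (mul_le_mul_of_nonneg_left hμlow hκ4.le) hh0.le)
    have hκμh : 0 ≤ κ * μ * h := by positivity
    rw [abs_le]; constructor <;> linarith [key.1, key.2, hJ', h24h]

end Summit.QuantumAdvantage.QuantumAdvantage.Theorems.DegreeOnePrimesEscape

end
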